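import Summits.BirchSwinnertonDyer.BirchSwinnertonDyer.Theorems.ByReductionTypeAtTwoP412KernelRankTransfer
import Summits.BirchSwinnertonDyer.BirchSwinnertonDyer.Theorems.ByReductionTypeAtTwoP412KernelSpecialisation
import Summits.BirchSwinnertonDyer.BirchSwinnertonDyer.Theorems.ByReductionTypeAtTwoMultTransportP49KernelOfLEO
import Summits.BirchSwinnertonDyer.BirchSwinnertonDyer.Theorems.ByReductionTypeAtTwoMultTransportP49KernelLEOSqueeze
import HarnessLib

/-!
# P412 in the kernel, VII — GREENBERG'S PROPOSITION 4.12 OVER `ℚ` (all `p`) FROM NAMED PRINTED FACTS: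
# `rank_Λ H¹(ℚ_Σ/ℚ_∞, E[p^∞])^∨ = 1 ⟹ H¹(ℚ_Σ/ℚ_∞, E[p^∞])` has no proper `Λ`-submodule of finite index

Cell `bsd-2adic` (run/shared/lean/pub/bsd-2adic/), seat `bsd-2adic-t42` GEN 20 (pen RC-315 (b): «GO — discharge P49 … and
sibling P412 (ss ♭-road `…SupersingularFlatDivAmbient` + θ-partner signed-control consumers), re-using BY NAME the
Greenberg-2006 engine»). HONEST FRAMING: research route; THEOREMS ONLY (no `def`, no named fact, no instance, no `sorry`);
nothing booked; BSD is not proved by any of this. PARTITION: K4 (TP2 `SignedControlAtTwo` doors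
`…SignedControlAtTwoOfPubThreeNotTorsion/OfPubTwoRelaxed`, `ResidualThetaTransportAtTwoRlf…`, `SignedLowerHalvesSharpFlat…OfGreenberg`,
CM rank-zero doors; ss ♭-road `…SupersingularFlatDivAmbient`) PRINT binder P412 =
`Greenberg1999.prop412_noFiniteSubmodule_H1Sigma_of_rank_one` × all p — reduces-the-named-input-of; bears_on K4 19097
(`--supports stmt-BirchSwinnertonDyer-19097`).

## What

**`prop412_noFiniteSubmodule_H1Sigma_of_facts`** — the named fact `Greenberg1999.prop412_noFiniteSubmodule_H1Sigma_of_rank_one`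
(LNM 1716 Prop. 4.12, second sentence, `F = ℚ`, every prime `p` — including `p = 2`) HOLDS granted SIX printed facts:
Greenberg 2006 Prop. 5.2 / Prop. 6.3 / Thm. 1 (i) (`GlobalH2Structure.lean`), Harari Thm. 17.13 (b), (a) for `ℚ`
(Poitou–Tate), and Tate's global Euler–Poincaré characteristic for `ℚ` (Milne I Thm. 5.1,
`tateGlobalEulerPoincareCharacteristic ℚ`). Chain (Greenberg's own, pp. 114–119):
rank transfer `rank_Λ Y = rank_Λ H¹(G_{ℚ,S}, 𝒜)^∨` (file I) ⟹ by the CORANK COUNT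
`rank H⁰^∨ − rank H¹^∨ + rank H²^∨ ≤ −1` (files II–VI: Greenberg 2006 p. 368 step without `cd ≤ 2`, Tate at `E[p^k]`,
growth, real place `#E[p^k]^{Γ_ℝ} ≤ 2p^k`) `rank_Λ H²(G_{ℚ,S}, 𝒜)^∨ = 0` ⟹ `H²` cotorsion ⟹ LEO(`𝒜`) ⟹ (GEN 18 engine
`P49Kernel.twist_surjective_of_kernelInputs`: Greenberg 2016 Prop. 2.6.1 / 2006 Thm. 1, Prop. 2.4, inputs (I2)–(I4) kernel)
`(u·conj_γ − 1)` acts ONTO `H¹(ℚ_Σ/ℚ_∞, E[p^∞])` ⟹ (`Greenberg1999.noFiniteSubmodule_dualH1Sigma_of_twist_surjective`) no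
non-zero finite `Λ`-submodule in `Y`. Compared with Prop. 4.9 (`P49Kernel.prop49_noFiniteSubmodule_H1Sigma_of_facts`, GEN 19),
the hypothesis «`Sel_E(ℚ_∞)_p` cotorsion» is replaced by «corank `1`» — the form valid at SUPERSINGULAR `p`.

References: [GreenbergLNM1716] §4 Props. 4.9–4.12, pp. 112–119; [Greenberg2006] Thm. 1, Props. 2.4, 3.2, 4.1, 5.2, 6.3;
[Greenberg2016Selmer] Prop. 2.6.1; [Harari2020] Thm. 17.13; [MilneADT2006] I Thm. 5.1.
-/

set_option autoImplicit false
set_option linter.dupNamespace false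

noncomputable section

open scoped Classical

namespace Summit.BirchSwinnertonDyer.BirchSwinnertonDyer.Theorems.P412Kernel

open NumberField IsDedekindDomain Field WeierstrassCurve
  Literature.NumberTheory.EllipticCurves Literature.NumberTheory.EllipticCurves.BigGaloisRep
  Literature.NumberTheory.EllipticCurves.Greenberg1999 Literature.NumberTheory.EllipticCurves.GreenbergVatsal2000
  Literature.NumberTheory.GaloisRepresentations Literature.NumberTheory.GaloisCohomology
  Literature.NumberTheory.IwasawaTheory.Greenberg2006 Literature.NumberTheory.IwasawaTheory.Greenberg2016
  Summit.BirchSwinnertonDyer.BirchSwinnertonDyer.Theorems.SignedBaseChangeAcDivCurveModel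
  Summit.BirchSwinnertonDyer.BirchSwinnertonDyer.Theorems.P49Kernel

/-! ## §1. Algebra: a finitely generated dual of rank `0` over a domain gives one non-zero annihilator -/

/-- If the character module of `M` is finitely generated of rank `0` over a domain `Λ`, ONE `r ≠ 0` kills `M`
(torsion + finite generation give `r ∈ Ann ∩ Λ⁰`; characters separate points). [cite: Greenberg2016Selmer, §2.2 p. 6 (LEO)] -/
theorem exists_ne_zero_forall_smul_eq_zero_of_finrank_characterModule_eq_zero
    {Λ : Type} [CommRing Λ] [IsDomain Λ] {M : Type} [AddCommGroup M] [Module Λ M]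
    [Module.Finite Λ (CharacterModule M)] (h0 : Module.finrank Λ (CharacterModule M) = 0) :
    ∃ r : Λ, r ≠ 0 ∧ ∀ c : M, r • c = 0 := by
  have hT : Module.IsTorsion Λ (CharacterModule M) := Module.finrank_eq_zero_iff_isTorsion.mp h0
  obtain ⟨r, hr, hr0⟩ := Submodule.annihilator_top_inter_nonZeroDivisors hT
  refine ⟨r, nonZeroDivisors.ne_zero hr0, fun c ↦ ?_⟩
  by_contra hne
  obtain ⟨χ, hχ⟩ := CharacterModule.exists_character_apply_ne_zero_of_ne_zero hne
  apply hχ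
  have hrχ : r • χ = 0 := Submodule.mem_annihilator.mp hr χ Submodule.mem_top
  have h' : (r • χ) c = (0 : CharacterModule M) c := congrArg (fun ψ : CharacterModule M ↦ ψ c) hrχ
  rw [CharacterModule.smul_apply] at h'
  exact h'

/-! ## §2. Proposition 4.12 over `ℚ` -/

section Assembly

/-- A finite place above `p` (lying-over for `ℤ ⊆ 𝓞 K`; as in file XLIX). [folklore] -/
private theorem exists_place_natCast_mem' {K : Type} [Field K] [NumberField K] (p : ℕ) [Fact p.Prime] :
    ∃ v : HeightOneSpectrum (𝓞 K), ((p : ℕ) : 𝓞 K) ∈ v.asIdeal := by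
  have hp : p.Prime := Fact.out
  have hp' : Prime (p : ℤ) := Nat.prime_iff_prime_int.mp hp
  haveI : (Ideal.span {(p : ℤ)}).IsPrime := (Ideal.span_singleton_prime hp'.ne_zero).mpr hp'
  have hinj : Function.Injective (algebraMap ℤ (𝓞 K)) := (algebraMap ℤ (𝓞 K)).injective_int
  obtain ⟨Q, -, hQ, hQp⟩ := Ideal.exists_ideal_over_prime_of_isIntegral
    (S := 𝓞 K) (Ideal.span {(p : ℤ)}) ⊥
    (by
      rw [← RingHom.ker_eq_comap_bot, (RingHom.injective_iff_ker_eq_bot _).mp hinj]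
      exact bot_le)
  have hmem : (p : ℤ) ∈ Q.comap (algebraMap ℤ (𝓞 K)) := by
    rw [hQp]
    exact Ideal.mem_span_singleton_self _
  have hQne : Q ≠ ⊥ := by
    intro hQbot
    rw [hQbot, Ideal.mem_comap, Ideal.mem_bot] at hmem
    exact hp'.ne_zero (hinj (by rw [hmem, map_zero]))
  refine ⟨⟨Q, hQ, hQne⟩, ?_⟩
  have := Ideal.mem_comap.mp hmem
  rwa [map_natCast] at this

/-- **GREENBERG'S PROPOSITION 4.12 OVER `ℚ` (every `p`) FROM SIX NAMED PRINTED FACTS**: if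
`H¹(ℚ_Σ/ℚ_∞, E[p^∞])` has `Λ`-corank `1` (any finitely generated Pontryagin-dual datum `Y` with `rank_Λ Y = 1`), then it
has no proper `Λ`-submodule of finite index (`Y` has no non-zero finite `Λ`-submodule) —
`Greenberg1999.prop412_noFiniteSubmodule_H1Sigma_of_rank_one` — granted Greenberg 2006 Prop. 5.2 / Prop. 6.3 / Thm. 1 (i),
Poitou–Tate 17.13 (b)(a) for `ℚ` and Tate's global Euler characteristic for `ℚ`; everything else (Shapiro, LOC, the
corank count with the real place at `p = 2`, LEO) is kernel. [cite: GreenbergLNM1716, Prop. 4.12 and its proof pp. 114–119]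
[cite: Greenberg2006, Thm. 1, Props. 2.4, 3.2, 5.2, 6.3] [cite: Greenberg2016Selmer, Prop. 2.6.1] [cite: Harari2020, Thm. 17.13]
[cite: MilneADT2006, I Thm. 5.1] -/
theorem prop412_noFiniteSubmodule_H1Sigma_of_facts
    (h52 : prop52_localH2_torsionBy_injective) (h63 : prop63_shaAway_smul_surjective)
    (hT1 : thm1_sha2_isCoreflexive)
    (hPTb : poitouTate_shaRestricted_tateDual ℚ) (hPTa : poitouTate_restricted_three_le ℚ)
    (hTate : tateGlobalEulerPoincareCharacteristic ℚ) :
    prop412_noFiniteSubmodule_H1Sigma_of_rank_one := by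
  intro W _ _ p _ κ γ hκ hγ S₀ hbad Y _ _ _ dY hbij hX hC hrank N hN
  letI : TopologicalSpace (IwasawaAlgebra p) := ⊥
  haveI : DiscreteTopology (IwasawaAlgebra p) := ⟨rfl⟩
  haveI : ContinuousAdd (IwasawaAlgebra p) := ⟨continuous_of_discreteTopology⟩
  haveI : ContinuousMul (IwasawaAlgebra p) := ⟨continuous_of_discreteTopology⟩
  haveI : ContinuousNeg (IwasawaAlgebra p) := ⟨continuous_of_discreteTopology⟩
  haveI : IsTopologicalRing (IwasawaAlgebra p) := IsTopologicalRing.mk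
  -- the set `S = Σ₀ ∪ {v ∣ p}` and the descended model `ρ₀` of `E[p^∞]` over `G_{ℚ,S}`
  have hS : (((↑S₀ : Set (HeightOneSpectrum (𝓞 ℚ))) ∪
      {v : HeightOneSpectrum (𝓞 ℚ) | ((p : ℕ) : 𝓞 ℚ) ∈ v.asIdeal})).Finite :=
    finite_union_setOf_natCast_mem p (Fact.out : p.Prime).ne_zero S₀
  have hSp := mem_union_setOf_natCast_mem (K := ℚ) p S₀
  have hSbad : ∀ w : HeightOneSpectrum (𝓞 ℚ), ¬ W.HasGoodReductionAt w →
      w ∈ ((↑S₀ : Set (HeightOneSpectrum (𝓞 ℚ))) ∪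
        {v : HeightOneSpectrum (𝓞 ℚ) | ((p : ℕ) : 𝓞 ℚ) ∈ v.asIdeal}) := fun w hw ↦ by
    by_contra h
    exact hw (hbad w (fun h' ↦ h (Or.inl h')) (fun h' ↦ h (Or.inr h')))
  have hNS : ∀ n ∈ ramificationSubgroup ℚ (((↑S₀ : Set (HeightOneSpectrum (𝓞 ℚ))) ∪
      {v : HeightOneSpectrum (𝓞 ℚ) | ((p : ℕ) : 𝓞 ℚ) ∈ v.asIdeal})),
      ∀ P : PrimaryTorsion W.geomPoints p, n • P = P := fun n hn P ↦
    smul_primaryTorsion_eq_of_mem_ramificationSubgroup W p _ hSbad hSp hn P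
  obtain ⟨ρ₀, hρ₀⟩ := exists_continuousRep_primaryTorsion W p _ hNS
  obtain ⟨η, hη⟩ := exists_place_natCast_mem' (K := ℚ) p
  set 𝒜 := bigRep (κ.liftUnramifiedOutside _ hSp) ρ₀ with h𝒜
  -- (I4) the Shapiro bridge
  obtain ⟨Sh, hSh⟩ := exists_shapiro_bridge W κ γ hγ (S₀ := (↑S₀ : Set (HeightOneSpectrum (𝓞 ℚ))))
    Set.subset_union_left hSp (fun v hv₀ hpv hv ↦ hv.elim hv₀ hpv) hNS 𝒜 (bigRep_lift_mk_apply W κ hSp ρ₀ hρ₀)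
  -- cofinite generation of `Hⁱ(G_S, 𝒜)` (Greenberg 2006 Prop. 3.2 from Poitou–Tate)
  obtain ⟨e⟩ := nonempty_ringEquiv_mvPowerSeries_fin_one p
  have hcof : ∀ i : ℕ, IsCofinitelyGenerated (IwasawaAlgebra p) (𝒜.H i) :=
    (prop32_of_poitouTate_at hPTb hPTa _ hS hSp e 𝒜 (isCofinitelyGenerated_bigRepModule p W)).1
  have hfin : ∀ i : ℕ, Module.Finite (IwasawaAlgebra p) (CharacterModule (𝒜.H i)) := fun i ↦
    isCofinitelyGenerated_iff_module_finite_characterModule.mp (hcof i)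
  haveI := hfin 0
  haveI := hfin 1
  haveI := hfin 2
  -- (R1) rank transfer: `rank_Λ H¹(G_S, 𝒜)^∨ = 1`
  have hSh1 : ∀ x : 𝒜.H 1,
      ((Sh ((PowerSeries.X : IwasawaAlgebra p) • x) :
        unramifiedOutside κ.kerSubgroup (W.geomPrimaryTorsion p) p (↑S₀ : Set (HeightOneSpectrum (𝓞 ℚ)))) :
          W.subgroupH1 p κ.kerSubgroup) = W.conjH1 p κ.kerSubgroup γ (Sh x) - Sh x := fun x ↦ by
    have h := hSh 1 x
    simp only [Int.cast_one, map_one, one_mul, sub_self, map_zero, add_zero, one_smul] at h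
    exact h
  have h1 : Module.finrank (IwasawaAlgebra p) (CharacterModule (𝒜.H 1)) = 1 :=
    finrank_characterModule_H_one_eq_one W κ hγ _ 𝒜 Sh hSh1 Y dY hbij hX hC hrank
  -- the corank count (files II–VI) ⟹ `rank_Λ H²(G_S, 𝒜)^∨ = 0` ⟹ LEO
  have hE := euler_characterModule_H_bigRep_le hPTb hPTa hTate W κ hS hSp ρ₀ hρ₀
  have h2 : Module.finrank (IwasawaAlgebra p) (CharacterModule (𝒜.H 2)) = 0 := by
    have h0 : (0 : ℤ) ≤ Module.finrank (IwasawaAlgebra p) (CharacterModule (𝒜.H 0)) := by positivity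
    rw [← h𝒜] at hE
    rw [h1] at hE
    push_cast at hE
    omega
  have hLEO : LEO _ 𝒜 :=
    leo_of_exists_ne_zero_forall_smul_eq_zero _ 𝒜
      (exists_ne_zero_forall_smul_eq_zero_of_finrank_characterModule_eq_zero h2)
  -- the engine: twisted surjectivity (Greenberg 2016 Prop. 2.6.1, 2006 Thm. 1, Prop. 2.4), then Greenberg's last step
  obtain ⟨u, hu, hsurj⟩ := twist_surjective_of_kernelInputs W κ γ _ h52 h63 hT1 hPTb hPTa hS hSp 𝒜 hLEO
    (hSp η hη) (loc1_bigRep_primaryTorsion_rat hκ hSp W ρ₀ hη) (fun v _ ↦ loc2_bigRep_primaryTorsion _ W ρ₀ v)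
    Sh hSh
  exact noFiniteSubmodule_dualH1Sigma_of_twist_surjective W p κ.kerSubgroup κ.isClosed_kerSubgroup γ
    _ hu hsurj Y dY hbij.1 hX hC N hN

end Assembly

end Summit.BirchSwinnertonDyer.BirchSwinnertonDyer.Theorems.P412Kernel

end
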